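import Summits.AtomisticToContinuum.FouriersLaw.Theorems.BondHeatUncertaintySubdiffusiveBondHeatJunctionDefectGrading

/-!
# `JunctionDefectGrading` — file 3: the BALANCED-SPLIT law with a SACRIFICED BUFFER (prover's choice of the cut)
# (cell `decomp-a2c`, lens-1 «grading / quantitative ladder», gen 56; beneath the 11071 line of record `BoundedResponse ⟸ DoublingLaw θ ∧ ExponentFloor s`)

File 1's kernel consumes, for every `N`, the ONE split `N = ⌊N/2⌋ + ⌈N/2⌉`, but its proof uses only that both parts are `≤ 2N/3` (gain
`(3/2)^{1−θ} > 1`, `rpow_split_gain`) and nearly exhaust `N`.  Both survive if (a) the cut sits ANYWHERE in the middle third (parts `u, v ≥ N/3`,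
the prover's choice, depending on `N` and `T`) and (b) a BUFFER of `L = N − u − v ≤ C·N^β` sites (`β < 1`, also the prover's) between the parts
is discarded — its linear worth is recovered by the same gain, with NO condition linking `β` to the floor.  Kernel `linear_of_split_of_floor`
(pure sequence analysis; defect exponent `θ < s`, buffer exponent `β < 1`, floor `0 ≤ s ≤ 1`; `θ < 0` = decaying defect allowed).  Pieces:
`SplitLaw θ` (`∃ C ≥ 0, ∃ β < 1, ∃ N₂, ∀ N ≥ N₂, ∃ u v, N ≤ 3u ∧ N ≤ 3v ∧ u + v ≤ N ∧ N − u − v ≤ C·N^β ∧ 1/E_u + 1/E_v − C·N^θ ≤ 1/E_N`;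
WEAKER than `DoublingLaw θ` ≤ `JunctionLaw θ` ≤ (θ = 0) 11748; UNDECIDED · IDEA-NEEDED · INSTRUMENTABLE — the census already shows the
buffered defect `C_L(u,v) = r_u + r_v − r_{u+L+v}` FALLING linearly in `L`, memo IDEA-g56) and its zero-defect fixed-buffer endpoint
`BufferedSeriesLaw` (`∃ L₀ N₂, ∀ u v ≥ N₂, 1/E_u + 1/E_v ≤ 1/E_{u+L₀+v}`: «a sacrificed block of FIXED length pays for the junction»; MECHANISM
piece, kinetic prediction `L₀ ≈ C₀·κ`, a mean free path).  Frame (11071 BY NAME): `boundedResponse_of_splitLaw_of_exponentFloor :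
θ < s → 0 ≤ s → s ≤ 1 → SplitLaw θ → ExponentFloor s → BoundedResponse`; `boundedResponse_of_splitLaw_neg : θ < 0 → SplitLaw θ → BoundedResponse`
(floor `F(0)` = tree `exponentFloor_zero_of_le_one`); `boundedResponse_of_bufferedSeriesLaw : BufferedSeriesLaw → BoundedResponse`.
The θ-axis of the junction ladder is thereby complete: `θ < 0` — the split law ALONE gives 11071; `0 ≤ θ < 1` — it needs the floor `F(s)`, `s > θ`
(sharp, file 1 `threshold_sharp`); `θ ≥ 1` — inert.  No `sorry`; standard axioms; imports only file 2 (tree).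
-/

noncomputable section

open Set

namespace Summit.AtomisticToContinuum.FouriersLaw.Theorems.SubdiffusiveBondHeat

namespace JunctionDefectGrading

open Summit.AtomisticToContinuum.FouriersLaw.Theses.BondHeatUncertainty (BoundedResponse)
open Summit.AtomisticToContinuum.FouriersLaw.Theorems.SubdiffusiveBondHeat.EscapeGrading
  (escapeDeficit OhmicFloor ohmicFloor_iff_boundedResponse ExponentFloor ExponentBootstrap
    exponentFloor_one_iff_ohmicFloor exponentFloor_zero_of_le_one)

/-! ## A. Kernel, balanced-split form with a sacrificed buffer (pure sequence analysis) -/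

/-- The gain step shared by the two exponents: if `u, v ≤ 2N/3`, `N − u − v ≤ C·N^β` and the second-order loss `g_e·C·N^{β−1} ≤ (g_e−1)/2`
(`g_e = (2/3)^{e−1}`), then `u^e + v^e ≥ (g_e − (g_e−1)/2)·N^e`. [kernel] -/
theorem split_gain_step {e β C : ℝ} {N u v : ℕ} (he : e ≤ 1) (hN : 0 < (N : ℝ)) (hu : 0 < (u : ℝ)) (hv : 0 < (v : ℝ))
    (hule : (u : ℝ) ≤ 2 / 3 * N) (hvle : (v : ℝ) ≤ 2 / 3 * N) (hbuf : (N : ℝ) - u - v ≤ C * (N : ℝ) ^ β)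
    (hloss : (2 / 3 : ℝ) ^ (e - 1) * C * (N : ℝ) ^ (β - 1) ≤ ((2 / 3 : ℝ) ^ (e - 1) - 1) / 2) :
    (2 / 3 : ℝ) ^ (e - 1) * (N : ℝ) ^ e - ((2 / 3 : ℝ) ^ (e - 1) - 1) / 2 * (N : ℝ) ^ e ≤ (u : ℝ) ^ e + (v : ℝ) ^ e := by
  obtain ⟨g, hg⟩ : ∃ g : ℝ, g = (2 / 3 : ℝ) ^ (e - 1) := ⟨_, rfl⟩
  have hg0 : 0 < g := by rw [hg]; exact Real.rpow_pos_of_pos (by norm_num) _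
  have hgu := rpow_split_gain he hu hule
  have hgv := rpow_split_gain he hv hvle
  rw [← hg] at hgu hgv hloss ⊢
  have hNe0 : 0 ≤ (N : ℝ) ^ e := Real.rpow_nonneg hN.le e
  have hT0 : 0 ≤ g * (N : ℝ) ^ (e - 1) := mul_nonneg hg0.le (Real.rpow_nonneg hN.le _)
  have hsum : g * (N : ℝ) ^ (e - 1) * ((u : ℝ) + v) ≤ (u : ℝ) ^ e + (v : ℝ) ^ e := by
    rw [mul_add]
    exact add_le_add hgu hgv
  have hTN : g * (N : ℝ) ^ (e - 1) * (N : ℝ) = g * (N : ℝ) ^ e := by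
    have h := Real.rpow_add_one hN.ne' (e - 1)
    rw [sub_add_cancel] at h
    rw [mul_assoc, h]
  have hcross : (N : ℝ) ^ (e - 1) * (N : ℝ) ^ β = (N : ℝ) ^ (β - 1) * (N : ℝ) ^ e := by
    have hexp : e - 1 + β = β - 1 + e := by ring
    rw [← Real.rpow_add hN, hexp, Real.rpow_add hN]
  have hbuf' : g * (N : ℝ) ^ (e - 1) * ((N : ℝ) - u - v) ≤ g * (N : ℝ) ^ (e - 1) * (C * (N : ℝ) ^ β) :=
    mul_le_mul_of_nonneg_left hbuf hT0
  have hsecond : g * (N : ℝ) ^ (e - 1) * (C * (N : ℝ) ^ β) ≤ (g - 1) / 2 * (N : ℝ) ^ e := by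
    have h := mul_le_mul_of_nonneg_right hloss hNe0
    calc g * (N : ℝ) ^ (e - 1) * (C * (N : ℝ) ^ β) = g * C * ((N : ℝ) ^ (e - 1) * (N : ℝ) ^ β) := by ring
      _ = g * C * (N : ℝ) ^ (β - 1) * (N : ℝ) ^ e := by rw [hcross]; ring
      _ ≤ (g - 1) / 2 * (N : ℝ) ^ e := h
  have e1 : g * (N : ℝ) ^ (e - 1) * ((N : ℝ) - u - v)
      = g * (N : ℝ) ^ (e - 1) * (N : ℝ) - g * (N : ℝ) ^ (e - 1) * ((u : ℝ) + v) := by ring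
  linarith [hsum, hbuf', hsecond, hTN, e1]

/-- **THE KERNEL — balanced-split form with a sacrificed buffer.**  If for every large `N` SOME decomposition `N = u + L + v` has both parts
in the middle third (`N ≤ 3u`, `N ≤ 3v`), buffer `L ≤ C·N^β` (`β < 1`) and `r_u + r_v − C·N^θ ≤ r_N`, and `c·N^s ≤ r_N` eventually (`0 ≤ s ≤ 1`,
`θ < s`, `θ < 0` allowed), then `a·N ≤ r_N` eventually, some `a > 0`.  Inductive minorant `a·N + B·N^θ + a·Q·N^β` (`B = 4C/(g_θ−1)` absorbs the
defect — where `θ < s` enters, via the seed window `[N₀, 3N₀)` —, `a·Q = 4aC/(g_β−1)` the buffer's linear worth; `g_e = (3/2)^{1−e}`). [kernel] -/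
theorem linear_of_split_of_floor {r : ℕ → ℝ} {θ β s C c : ℝ} {N₁ N₂ : ℕ}
    (hθs : θ < s) (hs0 : 0 ≤ s) (hs : s ≤ 1) (hβ : β < 1) (hC : 0 ≤ C) (hc : 0 < c)
    (hJ : ∀ N : ℕ, N₂ ≤ N → ∃ u v : ℕ, N ≤ 3 * u ∧ N ≤ 3 * v ∧ u + v ≤ N ∧
      (N : ℝ) - u - v ≤ C * (N : ℝ) ^ β ∧ r u + r v - C * (N : ℝ) ^ θ ≤ r N)
    (hF : ∀ N : ℕ, N₁ ≤ N → c * (N : ℝ) ^ s ≤ r N) :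
    ∃ a : ℝ, 0 < a ∧ ∃ N₀ : ℕ, ∀ N : ℕ, N₀ ≤ N → a * (N : ℝ) ≤ r N := by
  have hθ1 : θ ≤ 1 := by linarith
  have hc0 : c ≠ 0 := hc.ne'
  -- (1) gains `g = (2/3)^{θ−1}`, `g' = (2/3)^{β−1}`, budgets `B = 4C/(g−1)` (defect) and `Q = 4C/(g'−1)` (buffer, per unit rate)
  have gain : ∀ {e : ℝ}, e < 1 → 1 < (2 / 3 : ℝ) ^ (e - 1) := fun he => by
    rw [Real.one_lt_rpow_iff_of_pos (by norm_num : (0 : ℝ) < 2 / 3)]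
    exact Or.inr ⟨by norm_num, by linarith⟩
  obtain ⟨g, hg⟩ : ∃ g : ℝ, g = (2 / 3 : ℝ) ^ (θ - 1) := ⟨_, rfl⟩
  obtain ⟨g', hg'⟩ : ∃ g' : ℝ, g' = (2 / 3 : ℝ) ^ (β - 1) := ⟨_, rfl⟩
  have hg1 : 1 < g := by rw [hg]; exact gain (by linarith)
  have hg'1 : 1 < g' := by rw [hg']; exact gain hβ
  have hg0 : 0 < g := by linarith
  have hg'0 : 0 < g' := by linarith
  have hgne : g - 1 ≠ 0 := by intro h; linarith
  have hg'ne : g' - 1 ≠ 0 := by intro h; linarith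
  obtain ⟨B, hB⟩ : ∃ B : ℝ, B = 4 * C / (g - 1) := ⟨_, rfl⟩
  have hB0 : 0 ≤ B := by rw [hB]; exact div_nonneg (by positivity) (by linarith)
  have hBg : B * (g - 1) = 4 * C := by rw [hB]; exact div_mul_cancel₀ (4 * C) hgne
  obtain ⟨Q, hQ⟩ : ∃ Q : ℝ, Q = 4 * C / (g' - 1) := ⟨_, rfl⟩
  have hQ0 : 0 ≤ Q := by rw [hQ]; exact div_nonneg (by positivity) (by linarith)
  have hQg : Q * (g' - 1) = 4 * C := by rw [hQ]; exact div_mul_cancel₀ (4 * C) hg'ne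
  -- (2) thresholds: `K = 3B/c ≤ N₀^{s−θ}`; `M = 2gC/(g−1) ≤ N₀^{1−β}` and `M' = 2g'C/(g'−1) ≤ N₀^{1−β}` (second-order losses)
  have hsθ : 0 < s - θ := by linarith
  have h1β : 0 < 1 - β := by linarith
  obtain ⟨K, hK⟩ : ∃ K : ℝ, K = 3 * B / c := ⟨_, rfl⟩
  have hK0 : 0 ≤ K := by rw [hK]; positivity
  have hBK : B = c / 3 * K := by rw [hK]; field_simp
  obtain ⟨M, hM⟩ : ∃ M : ℝ, M = 2 * g * C / (g - 1) := ⟨_, rfl⟩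
  have hM0 : 0 ≤ M := by rw [hM]; exact div_nonneg (by positivity) (by linarith)
  have hMg : (g - 1) / 2 * M = g * C := by rw [hM]; field_simp
  obtain ⟨M', hM'⟩ : ∃ M' : ℝ, M' = 2 * g' * C / (g' - 1) := ⟨_, rfl⟩
  have hM'0 : 0 ≤ M' := by rw [hM']; exact div_nonneg (by positivity) (by linarith)
  have hM'g : (g' - 1) / 2 * M' = g' * C := by rw [hM']; field_simp
  obtain ⟨Nk, hNk⟩ := exists_nat_ge (K ^ (1 / (s - θ)))
  obtain ⟨Nm, hNm⟩ := exists_nat_ge (M ^ (1 / (1 - β)))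
  obtain ⟨Nm', hNm'⟩ := exists_nat_ge (M' ^ (1 / (1 - β)))
  obtain ⟨N₀, hN₀1, hN₀2, hN₀two, hN₀k, hN₀m, hN₀m'⟩ :
      ∃ N₀ : ℕ, N₁ ≤ N₀ ∧ N₂ ≤ N₀ ∧ 2 ≤ N₀ ∧ Nk ≤ N₀ ∧ Nm ≤ N₀ ∧ Nm' ≤ N₀ :=
    ⟨N₁ + N₂ + 2 + Nk + Nm + Nm', by omega, by omega, by omega, by omega, by omega, by omega⟩
  have hN₀pos : (0 : ℝ) < N₀ := by exact_mod_cast lt_of_lt_of_le (by norm_num) hN₀two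
  have rpow_thresh : ∀ {X e : ℝ} {Nx : ℕ}, 0 ≤ X → 0 < e → X ^ (1 / e) ≤ (Nx : ℝ) → Nx ≤ N₀ → X ≤ (N₀ : ℝ) ^ e := by
    intro X e Nx hX he hNx hle
    have h1 : X ^ (1 / e) ≤ (N₀ : ℝ) := le_trans hNx (by exact_mod_cast hle)
    have h2 : (X ^ (1 / e)) ^ e ≤ (N₀ : ℝ) ^ e := Real.rpow_le_rpow (Real.rpow_nonneg hX _) h1 he.le
    have h3 : (X ^ (1 / e)) ^ e = X := by rw [← Real.rpow_mul hX, one_div_mul_cancel he.ne', Real.rpow_one]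
    rwa [h3] at h2
  have hN₀K : K ≤ (N₀ : ℝ) ^ (s - θ) := rpow_thresh hK0 hsθ hNk hN₀k
  have hN₀M : M ≤ (N₀ : ℝ) ^ (1 - β) := rpow_thresh hM0 h1β hNm hN₀m
  have hN₀M' : M' ≤ (N₀ : ℝ) ^ (1 - β) := rpow_thresh hM'0 h1β hNm' hN₀m'
  -- second-order losses beyond `N₀`: `γ·C·N^{β−1} ≤ (γ−1)/2` for `γ ∈ {g, g'}`
  have loss : ∀ {γ Mγ : ℝ}, 0 < γ → (γ - 1) / 2 * Mγ = γ * C → Mγ ≤ (N₀ : ℝ) ^ (1 - β) → 1 < γ →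
      ∀ N : ℕ, N₀ ≤ N → γ * C * (N : ℝ) ^ (β - 1) ≤ (γ - 1) / 2 := by
    intro γ Mγ hγ0 hMγ hN₀Mγ hγ1 N hN
    have hP : 0 < (N₀ : ℝ) ^ (1 - β) := Real.rpow_pos_of_pos hN₀pos _
    have hγC : γ * C ≤ (γ - 1) / 2 * (N₀ : ℝ) ^ (1 - β) := by
      rw [← hMγ]
      exact mul_le_mul_of_nonneg_left hN₀Mγ (by linarith)
    have hinv : (N₀ : ℝ) ^ (β - 1) = ((N₀ : ℝ) ^ (1 - β))⁻¹ := by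
      rw [← Real.rpow_neg hN₀pos.le]; congr 1; ring
    have h0 : γ * C * (N₀ : ℝ) ^ (β - 1) ≤ (γ - 1) / 2 := by
      rw [hinv, ← div_eq_mul_inv, div_le_iff₀ hP]
      exact hγC
    have hanti : (N : ℝ) ^ (β - 1) ≤ (N₀ : ℝ) ^ (β - 1) :=
      Real.rpow_le_rpow_of_nonpos hN₀pos (by exact_mod_cast hN) (by linarith)
    exact le_trans (mul_le_mul_of_nonneg_left hanti (mul_nonneg hγ0.le hC)) h0
  have hloss : ∀ N : ℕ, N₀ ≤ N → g * C * (N : ℝ) ^ (β - 1) ≤ (g - 1) / 2 := loss hg0 hMg hN₀M hg1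
  have hloss' : ∀ N : ℕ, N₀ ≤ N → g' * C * (N : ℝ) ^ (β - 1) ≤ (g' - 1) / 2 := loss hg'0 hM'g hN₀M' hg'1
  -- (3) the linear rate `a = c·N₀^s/(9(1+Q)N₀)` and the buffer budget `B' = a·Q`
  have hQ1 : 0 < 1 + Q := by linarith
  obtain ⟨a, ha⟩ : ∃ a : ℝ, a = c * (N₀ : ℝ) ^ s / (9 * (1 + Q) * N₀) := ⟨_, rfl⟩
  have ha0 : 0 < a := by rw [ha]; positivity
  have ha3 : a * (1 + Q) * (3 * N₀) = c / 3 * (N₀ : ℝ) ^ s := by rw [ha]; field_simp; ring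
  obtain ⟨B', hB'⟩ : ∃ B' : ℝ, B' = a * Q := ⟨_, rfl⟩
  have hB'0 : 0 ≤ B' := by rw [hB']; exact mul_nonneg ha0.le hQ0
  have hB'g : B' * (g' - 1) = 4 * (a * C) := by rw [hB', mul_assoc, hQg]; ring
  -- (4) the inductive minorant `a·N + B·N^θ + B'·N^β ≤ r_N` for `N ≥ N₀`
  have key : ∀ N : ℕ, N₀ ≤ N → a * N + B * (N : ℝ) ^ θ + B' * (N : ℝ) ^ β ≤ r N := by
    intro N
    refine Nat.strong_induction_on N fun N ih => ?_
    intro hN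
    have hN2 : 2 ≤ N := le_trans hN₀two hN
    have hNpos : (0 : ℝ) < N := by exact_mod_cast lt_of_lt_of_le (by norm_num) hN2
    have hN1 : (1 : ℝ) ≤ N := by exact_mod_cast le_trans (by norm_num : 1 ≤ 2) hN2
    have hNθ0 : 0 ≤ (N : ℝ) ^ θ := Real.rpow_nonneg hNpos.le θ
    have hNβ0 : 0 ≤ (N : ℝ) ^ β := Real.rpow_nonneg hNpos.le β
    by_cases hsmall : N < 3 * N₀
    · -- seed window `N₀ ≤ N < 3N₀`: everything from the floor, split into thirds
      have hFN : c * (N : ℝ) ^ s ≤ r N := hF N (le_trans hN₀1 hN)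
      have hmono : (N₀ : ℝ) ^ s ≤ (N : ℝ) ^ s := Real.rpow_le_rpow hN₀pos.le (by exact_mod_cast hN) hs0
      have hNs0 : 0 ≤ (N : ℝ) ^ s := Real.rpow_nonneg hNpos.le s
      have hN3 : (N : ℝ) ≤ 3 * N₀ := by exact_mod_cast hsmall.le
      -- defect budget: `B·N^θ ≤ (c/3)·N^s`
      have hBN : B * (N : ℝ) ^ θ ≤ c / 3 * (N : ℝ) ^ s := by
        have hsplit : (N : ℝ) ^ s = (N : ℝ) ^ (s - θ) * (N : ℝ) ^ θ := by
          rw [← Real.rpow_add hNpos]; congr 1; ring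
        have hmono' : (N₀ : ℝ) ^ (s - θ) ≤ (N : ℝ) ^ (s - θ) :=
          Real.rpow_le_rpow hN₀pos.le (by exact_mod_cast hN) hsθ.le
        have hKN : K * (N : ℝ) ^ θ ≤ (N : ℝ) ^ (s - θ) * (N : ℝ) ^ θ :=
          mul_le_mul_of_nonneg_right (le_trans hN₀K hmono') hNθ0
        rw [hsplit, hBK]
        calc c / 3 * K * (N : ℝ) ^ θ = c / 3 * (K * (N : ℝ) ^ θ) := by ring
          _ ≤ c / 3 * ((N : ℝ) ^ (s - θ) * (N : ℝ) ^ θ) := mul_le_mul_of_nonneg_left hKN (by positivity)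
      -- linear + buffer budget: `a·N + B'·N^β ≤ a(1+Q)·N ≤ a(1+Q)·3N₀ = (c/3)·N₀^s ≤ (c/3)·N^s`
      have hβN : (N : ℝ) ^ β ≤ N := by
        have h := Real.rpow_le_rpow_of_exponent_le hN1 hβ.le
        rwa [Real.rpow_one] at h
      have hB'N : B' * (N : ℝ) ^ β ≤ a * Q * N := by
        rw [hB']
        exact mul_le_mul_of_nonneg_left hβN (mul_nonneg ha0.le hQ0)
      have haN : a * (1 + Q) * N ≤ c / 3 * (N : ℝ) ^ s :=
        calc a * (1 + Q) * N ≤ a * (1 + Q) * (3 * N₀) := mul_le_mul_of_nonneg_left hN3 (by positivity)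
          _ = c / 3 * (N₀ : ℝ) ^ s := ha3
          _ ≤ c / 3 * (N : ℝ) ^ s := mul_le_mul_of_nonneg_left hmono (by positivity)
      have e0 : a * (1 + Q) * (N : ℝ) = a * N + a * Q * N := by ring
      have hcs : 0 ≤ c / 3 * (N : ℝ) ^ s := by positivity
      linarith
    · -- a balanced split with buffer, supplied by the hypothesis
      push Not at hsmall
      obtain ⟨u, v, h3u, h3v, huv, hbuf, hJN⟩ := hJ N (le_trans hN₀2 hN)
      have hu₀ : N₀ ≤ u := by omega
      have hv₀ : N₀ ≤ v := by omega
      have huN : u < N := by omega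
      have hvN : v < N := by omega
      have h3u2 : 3 * u ≤ 2 * N := by omega
      have h3v2 : 3 * v ≤ 2 * N := by omega
      have ihu := ih u huN hu₀
      have ihv := ih v hvN hv₀
      have hupos : (0 : ℝ) < u := by exact_mod_cast lt_of_lt_of_le (by norm_num) (le_trans hN₀two hu₀)
      have hvpos : (0 : ℝ) < v := by exact_mod_cast lt_of_lt_of_le (by norm_num) (le_trans hN₀two hv₀)
      have hule : (u : ℝ) ≤ 2 / 3 * N := by
        have h1 : 3 * (u : ℝ) ≤ 2 * N := by exact_mod_cast h3u2
        linarith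
      have hvle : (v : ℝ) ≤ 2 / 3 * N := by
        have h1 : 3 * (v : ℝ) ≤ 2 * N := by exact_mod_cast h3v2
        linarith
      -- gains on the two exponents
      have hcombθ := split_gain_step hθ1 hNpos hupos hvpos hule hvle hbuf (by rw [← hg]; exact hloss N hN)
      have hcombβ := split_gain_step hβ.le hNpos hupos hvpos hule hvle hbuf (by rw [← hg']; exact hloss' N hN)
      rw [← hg] at hcombθ
      rw [← hg'] at hcombβ
      have hBcomb : B * (g * (N : ℝ) ^ θ - (g - 1) / 2 * (N : ℝ) ^ θ) ≤ B * ((u : ℝ) ^ θ + (v : ℝ) ^ θ) :=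
        mul_le_mul_of_nonneg_left hcombθ hB0
      have hBval : B * (g * (N : ℝ) ^ θ - (g - 1) / 2 * (N : ℝ) ^ θ) = B * (N : ℝ) ^ θ + 2 * C * (N : ℝ) ^ θ := by
        have e2 : B * (g * (N : ℝ) ^ θ - (g - 1) / 2 * (N : ℝ) ^ θ)
            = B * (N : ℝ) ^ θ + B * (g - 1) / 2 * (N : ℝ) ^ θ := by ring
        rw [e2, mul_div_assoc, ← mul_div_assoc, hBg]
        ring
      have hB'comb : B' * (g' * (N : ℝ) ^ β - (g' - 1) / 2 * (N : ℝ) ^ β) ≤ B' * ((u : ℝ) ^ β + (v : ℝ) ^ β) :=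
        mul_le_mul_of_nonneg_left hcombβ hB'0
      have hB'val : B' * (g' * (N : ℝ) ^ β - (g' - 1) / 2 * (N : ℝ) ^ β) = B' * (N : ℝ) ^ β + 2 * (a * C) * (N : ℝ) ^ β := by
        have e2 : B' * (g' * (N : ℝ) ^ β - (g' - 1) / 2 * (N : ℝ) ^ β)
            = B' * (N : ℝ) ^ β + B' * (g' - 1) / 2 * (N : ℝ) ^ β := by ring
        rw [e2, mul_div_assoc, ← mul_div_assoc, hB'g]
        ring
      -- the buffer's linear worth `a·(N − u − v) ≤ a·C·N^β`
      have habuf : a * ((N : ℝ) - u - v) ≤ a * (C * (N : ℝ) ^ β) := mul_le_mul_of_nonneg_left hbuf ha0.le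
      have e3 : a * ((N : ℝ) - u - v) = a * (N : ℝ) - a * (u : ℝ) - a * (v : ℝ) := by ring
      have hCθ : 0 ≤ C * (N : ℝ) ^ θ := mul_nonneg hC hNθ0
      have haCβ : 0 ≤ a * C * (N : ℝ) ^ β := mul_nonneg (mul_nonneg ha0.le hC) hNβ0
      linarith [ihu, ihv, hJN, hBcomb, hBval, hB'comb, hB'val, habuf, e3]
  -- (5) conclusion
  refine ⟨a, ha0, N₀, fun N hN => ?_⟩
  have h := key N hN
  have h1 : 0 ≤ B * (N : ℝ) ^ θ := mul_nonneg hB0 (Real.rpow_nonneg (Nat.cast_nonneg N) θ)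
  have h2 : 0 ≤ B' * (N : ℝ) ^ β := mul_nonneg hB'0 (Real.rpow_nonneg (Nat.cast_nonneg N) β)
  linarith

/-- The near-diagonal doubling hypothesis of file 1 is the special case «cut at `⌊N/2⌋`, empty buffer» (any buffer exponent). [kernel] -/
theorem split_of_doubling {r : ℕ → ℝ} {θ β C : ℝ} (hC : 0 ≤ C)
    (hJ : ∀ N M : ℕ, 2 ≤ N → (M = N ∨ M = N + 1) → r N + r M - C * ((N : ℝ) + M) ^ θ ≤ r (N + M)) :
    ∀ N : ℕ, 4 ≤ N → ∃ u v : ℕ, N ≤ 3 * u ∧ N ≤ 3 * v ∧ u + v ≤ N ∧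
      (N : ℝ) - u - v ≤ C * (N : ℝ) ^ β ∧ r u + r v - C * (N : ℝ) ^ θ ≤ r N := by
  intro N hN
  have hsum : N / 2 + (N - N / 2) = N := by omega
  have hcast : ((N / 2 : ℕ) : ℝ) + ((N - N / 2 : ℕ) : ℝ) = (N : ℝ) := by exact_mod_cast hsum
  refine ⟨N / 2, N - N / 2, by omega, by omega, by omega, ?_, ?_⟩
  · have h0 : 0 ≤ C * (N : ℝ) ^ β := mul_nonneg hC (Real.rpow_nonneg (Nat.cast_nonneg N) β)
    linarith
  · have h := hJ (N / 2) (N - N / 2) (by omega) (by omega)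
    rw [hsum, hcast] at h
    exact h

/-! ## B. The pieces -/

/-- **Balanced-split law with defect exponent `θ` and a sacrificed sublinear buffer** (prover's choice of cut, buffer and buffer exponent):
for all parameters and `T > 0`, `∃ C ≥ 0, ∃ β < 1, ∃ N₂, ∀ N ≥ N₂, ∃ u v, N ≤ 3u ∧ N ≤ 3v ∧ u + v ≤ N ∧ N − u − v ≤ C·N^β ∧
1/E_u + 1/E_v − C·N^θ ≤ 1/E_N`.  `θ < 0` = decaying defect.  Tags: WEAKER than `DoublingLaw θ` ≤ `JunctionLaw θ` ≤ (θ = 0) 11748 and than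
`BufferedSeriesLaw`; UNDECIDED · IDEA-NEEDED (typed form of the «sacrificed buffer» mechanism, memo IDEA-g56) · INSTRUMENTABLE (census: the
buffered defect falls linearly in the buffer length); no Fourier content alone for `θ ≥ 0` (bounded `r`), but ALONE sufficient for `θ < 0`
(`boundedResponse_of_splitLaw_neg`); inert for `θ ≥ 1`. [piece · rung] -/
def SplitLaw (θ : ℝ) : Prop :=
  ∀ ω₂ lam β γ : ℝ, 0 < ω₂ → 0 < lam → 0 < β → 0 < γ → ∀ T : ℝ, 0 < T →
    ∃ C : ℝ, 0 ≤ C ∧ ∃ b : ℝ, b < 1 ∧ ∃ N₂ : ℕ, ∀ N : ℕ, N₂ ≤ N → ∃ u v : ℕ, N ≤ 3 * u ∧ N ≤ 3 * v ∧ u + v ≤ N ∧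
      (N : ℝ) - u - v ≤ C * (N : ℝ) ^ b ∧
      1 / escapeDeficit ω₂ lam β γ T u + 1 / escapeDeficit ω₂ lam β γ T v - C * (N : ℝ) ^ θ
        ≤ 1 / escapeDeficit ω₂ lam β γ T N

/-- **Buffered series law** (zero defect, fixed buffer): for all parameters and `T > 0`, `∃ L₀ N₂, ∀ u v ≥ N₂, 1/E_u + 1/E_v ≤ 1/E_{u+L₀+v}` —
a sacrificed block of FIXED length `L₀(T)` pays for the junction.  MECHANISM piece (kinetic prediction: `L₀ ≈` contact defect × conductivity,
a mean free path; census-supported at `T ∈ {3, 10}`); phonon-false at the harmonic member; UNDECIDED · IDEA-NEEDED · INSTRUMENTABLE.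
Implies `SplitLaw θ` for every `θ`, hence 11071 alone. [piece · mechanism] -/
def BufferedSeriesLaw : Prop :=
  ∀ ω₂ lam β γ : ℝ, 0 < ω₂ → 0 < lam → 0 < β → 0 < γ → ∀ T : ℝ, 0 < T →
    ∃ L₀ N₂ : ℕ, ∀ u v : ℕ, N₂ ≤ u → N₂ ≤ v →
      1 / escapeDeficit ω₂ lam β γ T u + 1 / escapeDeficit ω₂ lam β γ T v ≤ 1 / escapeDeficit ω₂ lam β γ T (u + L₀ + v)

/-- `D(θ) ⟹ S(θ)` (cut at `⌊N/2⌋`, empty buffer, `N ≥ 4`). [folklore] -/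
theorem splitLaw_of_doublingLaw {θ : ℝ} : DoublingLaw θ → SplitLaw θ := by
  intro hD ω₂ lam β γ hω hl hβ hγ T hT
  obtain ⟨C, hC, h⟩ := hD ω₂ lam β γ hω hl hβ hγ T hT
  exact ⟨C, hC, 0, zero_lt_one, 4, split_of_doubling (r := fun N => 1 / escapeDeficit ω₂ lam β γ T N) hC h⟩

/-- `J(θ) ⟹ S(θ)`. [folklore] -/
theorem splitLaw_of_junctionLaw {θ : ℝ} (hJ : JunctionLaw θ) : SplitLaw θ :=
  splitLaw_of_doublingLaw (doublingLaw_of_junctionLaw hJ)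

/-- Monotonicity of the split ladder in `θ`. [folklore] -/
theorem splitLaw_mono {θ θ' : ℝ} (hθθ' : θ ≤ θ') : SplitLaw θ → SplitLaw θ' := by
  intro hS ω₂ lam β γ hω hl hβ hγ T hT
  obtain ⟨C, hC, b, hb, N₂, h⟩ := hS ω₂ lam β γ hω hl hβ hγ T hT
  refine ⟨C, hC, b, hb, max N₂ 1, fun N hN => ?_⟩
  obtain ⟨u, v, h3u, h3v, huv, hbuf, hJ⟩ := h N (le_trans (le_max_left _ _) hN)
  have hN1 : (1 : ℝ) ≤ N := by exact_mod_cast le_trans (le_max_right N₂ 1) hN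
  have hmono : (N : ℝ) ^ θ ≤ (N : ℝ) ^ θ' := Real.rpow_le_rpow_of_exponent_le hN1 hθθ'
  have hCm : C * (N : ℝ) ^ θ ≤ C * (N : ℝ) ^ θ' := mul_le_mul_of_nonneg_left hmono hC
  exact ⟨u, v, h3u, h3v, huv, hbuf, by linarith⟩

/-- `BufferedSeriesLaw ⟹ SplitLaw θ` for EVERY `θ` (cut `N − L₀` in half; buffer `L₀ ≤ L₀·N⁰`; defect `0 ≤ C·N^θ`). [folklore] -/
theorem splitLaw_of_bufferedSeriesLaw (θ : ℝ) (hB : BufferedSeriesLaw) : SplitLaw θ := by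
  intro ω₂ lam β γ hω hl hβ hγ T hT
  obtain ⟨L₀, N₂, h⟩ := hB ω₂ lam β γ hω hl hβ hγ T hT
  refine ⟨L₀, by exact_mod_cast Nat.zero_le L₀, 0, zero_lt_one, 3 * L₀ + 2 * N₂ + 4, fun N hN => ?_⟩
  have hNpos : (0 : ℝ) < N := by exact_mod_cast (show 0 < N by omega)
  refine ⟨(N - L₀) / 2, N - L₀ - (N - L₀) / 2, by omega, by omega, by omega, ?_, ?_⟩
  · have hsum : (N - L₀) / 2 + (N - L₀ - (N - L₀) / 2) + L₀ = N := by omega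
    have hcast : (((N - L₀) / 2 : ℕ) : ℝ) + ((N - L₀ - (N - L₀) / 2 : ℕ) : ℝ) + (L₀ : ℝ) = (N : ℝ) := by exact_mod_cast hsum
    rw [Real.rpow_zero, mul_one]
    linarith
  · have hle := h ((N - L₀) / 2) (N - L₀ - (N - L₀) / 2) (by omega) (by omega)
    have hsum : (N - L₀) / 2 + L₀ + (N - L₀ - (N - L₀) / 2) = N := by omega
    rw [hsum] at hle
    have h0 : 0 ≤ (L₀ : ℝ) * (N : ℝ) ^ θ := mul_nonneg (Nat.cast_nonneg L₀) (Real.rpow_nonneg hNpos.le θ)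
    linarith

/-! ## C. The frame -/

/-- **`SplitLaw θ → ExponentFloor s → OhmicFloor`** for `θ < s`, `0 ≤ s ≤ 1`: the kernel applied to `r_N = 1/E_N(T)` at each temperature (split
parts `u, v ≥ N/3 ≥ 2`, so all `E`'s involved are positive by `escapeDeficit_pos`). [kernel · frame] -/
theorem ohmicFloor_of_splitLaw_of_exponentFloor {θ s : ℝ} (hθs : θ < s) (hs0 : 0 ≤ s) (hs : s ≤ 1)
    (hS : SplitLaw θ) (hF : ExponentFloor s) : OhmicFloor := by
  intro ω₂ lam β γ hω hl hβ hγ T hT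
  obtain ⟨C, hC, b, hb, N₂, hS'⟩ := hS ω₂ lam β γ hω hl hβ hγ T hT
  obtain ⟨c', N₁, hF'⟩ := hF ω₂ lam β γ hω hl hβ hγ T hT
  have hpos : ∀ N : ℕ, 2 ≤ N → 0 < escapeDeficit ω₂ lam β γ T N := fun N hN =>
    escapeDeficit_pos hω hl hβ hγ hT hN
  have hc' : 0 < c' := by
    have hle := hF' (max N₁ 2) (le_max_left _ _)
    have hE := hpos (max N₁ 2) (le_max_right _ _)
    have hx : (0 : ℝ) < ((max N₁ 2 : ℕ) : ℝ) ^ s :=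
      Real.rpow_pos_of_pos (by exact_mod_cast lt_of_lt_of_le (by norm_num) (le_max_right N₁ 2)) s
    have h := lt_of_lt_of_le hE hle
    by_contra hcn
    push Not at hcn
    have : c' / ((max N₁ 2 : ℕ) : ℝ) ^ s ≤ 0 := div_nonpos_iff.mpr (Or.inr ⟨hcn, hx.le⟩)
    linarith
  have hFr : ∀ N : ℕ, max N₁ 2 ≤ N → 1 / c' * (N : ℝ) ^ s ≤ 1 / escapeDeficit ω₂ lam β γ T N := by
    intro N hN
    have hE := hpos N (le_trans (le_max_right _ _) hN)
    have hle := hF' N (le_trans (le_max_left _ _) hN)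
    have hx : (0 : ℝ) < (N : ℝ) ^ s :=
      Real.rpow_pos_of_pos (by exact_mod_cast lt_of_lt_of_le (by norm_num) (le_trans (le_max_right N₁ 2) hN)) s
    have h1 : escapeDeficit ω₂ lam β γ T N * (N : ℝ) ^ s ≤ c' := (le_div_iff₀ hx).mp hle
    rw [one_div_mul_eq_div, div_le_iff₀ hc', one_div_mul_eq_div, le_div_iff₀ hE, mul_comm]
    exact h1
  obtain ⟨a, ha, N₀, hlin⟩ := linear_of_split_of_floor
    (r := fun N => 1 / escapeDeficit ω₂ lam β γ T N) hθs hs0 hs hb hC (one_div_pos.mpr hc') hS' hFr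
  refine ⟨1 / a, max N₀ 2, fun N hN => ?_⟩
  have hE := hpos N (le_trans (le_max_right _ _) hN)
  have hNpos : (0 : ℝ) < N := by
    exact_mod_cast lt_of_lt_of_le (by norm_num) (le_trans (le_max_right N₀ 2) hN)
  have h : a * (N : ℝ) ≤ 1 / escapeDeficit ω₂ lam β γ T N := hlin N (le_trans (le_max_left _ _) hN)
  have h' : a * (N : ℝ) * escapeDeficit ω₂ lam β γ T N ≤ 1 := (le_div_iff₀ hE).mp h
  rw [div_div, le_div_iff₀ (mul_pos ha hNpos)]
  calc escapeDeficit ω₂ lam β γ T N * (a * N) = a * (N : ℝ) * escapeDeficit ω₂ lam β γ T N := by ring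
    _ ≤ 1 := h'

/-- **THE NODE, balanced-split form: `SplitLaw θ → ExponentFloor s → BoundedResponse` (11071) for `θ < s`, `0 ≤ s ≤ 1`.** [kernel · frame] -/
theorem boundedResponse_of_splitLaw_of_exponentFloor {θ s : ℝ} (hθs : θ < s) (hs0 : 0 ≤ s) (hs : s ≤ 1) :
    SplitLaw θ → ExponentFloor s → BoundedResponse := fun hS hF =>
  ohmicFloor_iff_boundedResponse.1 (ohmicFloor_of_splitLaw_of_exponentFloor hθs hs0 hs hS hF)

/-- `S(θ)` OWNS gen-55's bootstrap half: `SplitLaw θ → ExponentBootstrap s` for `θ < s`, `0 ≤ s ≤ 1`. [kernel · frame] -/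
theorem exponentBootstrap_of_splitLaw {θ s : ℝ} (hθs : θ < s) (hs0 : 0 ≤ s) (hs : s ≤ 1) (hS : SplitLaw θ) :
    ExponentBootstrap s := fun hF =>
  (exponentFloor_one_iff_ohmicFloor).2 (ohmicFloor_of_splitLaw_of_exponentFloor hθs hs0 hs hS hF)

/-- **A DECAYING defect needs no floor: `SplitLaw θ → BoundedResponse` for `θ < 0`** (the floor `F(0)` is the tree theorem
`exponentFloor_zero_of_le_one`, i.e. `E_N ≤ 1`). [kernel · frame] -/
theorem boundedResponse_of_splitLaw_neg {θ : ℝ} (hθ : θ < 0) : SplitLaw θ → BoundedResponse := fun hS =>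
  boundedResponse_of_splitLaw_of_exponentFloor hθ le_rfl zero_le_one hS exponentFloor_zero_of_le_one

/-- **`BufferedSeriesLaw → BoundedResponse`**: a fixed sacrificed buffer with zero defect gives 11071 outright. [kernel · frame] -/
theorem boundedResponse_of_bufferedSeriesLaw : BufferedSeriesLaw → BoundedResponse := fun hB =>
  boundedResponse_of_splitLaw_neg (θ := -1) (by norm_num) (splitLaw_of_bufferedSeriesLaw (-1) hB)

/-- Packaged: `(∃ θ s, θ < s ∧ 0 ≤ s ∧ s ≤ 1 ∧ SplitLaw θ ∧ ExponentFloor s) → BoundedResponse`. [kernel · frame] -/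
theorem boundedResponse_of_exists_split_grading :
    (∃ θ s : ℝ, θ < s ∧ 0 ≤ s ∧ s ≤ 1 ∧ SplitLaw θ ∧ ExponentFloor s) → BoundedResponse := by
  rintro ⟨θ, s, hθs, hs0, hs, hS, hF⟩
  exact boundedResponse_of_splitLaw_of_exponentFloor hθs hs0 hs hS hF

end JunctionDefectGrading

end Summit.AtomisticToContinuum.FouriersLaw.Theorems.SubdiffusiveBondHeat

end
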